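import Summits.QuantumFields.YangMills.Theorems.BalabanUVNodesN05SubBP2CSlotExistsGammaPrime

/-!
# BalabanUVNodes ∕ N05 ([Balaban1985RegularSpaces] Lemma 1 p. 79 – Thm 8 p. 101): THE RE-PINNED SLOT INHABITED WITH PROPOSITION 5's FAMILY = THE LANDAU DATA OF
# EVERY COLLAR LAW MEMBER AT EVERY UNITARY BACKGROUND — the `zdLan` letters of `BalabanUVNodesN05SubBP2CSlotExistsGammaPrime` DERIVED from [4]'s letters at the law
# members, so the engine row `h05 ↦ ∃ lam8, B8LeafOfRecordSubBP₂C θ₃ lam8` follows from FIVE [4]-type families at the collar law members and nothing else, WITH a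
# certificate that the layer's Proposition-5 family is the honest one (not the empty family the ∃λ currency would also admit)

Track A of `YM-PLAN.md` (cell `pub-ymgap`, HUMAN RULING D-0062), node **N05**; seat `pub-ymgap-dag-n05-d` (g12), 2026-08-28; bears on K1⁷ `stmt-QuantumFields-20542`
(`--supports … --as helper`, count-neutral).

WHY (a located narrowness of the ∃λ currency, and its cure inside the theorem).  The residual [B8] layer CHOOSES Proposition 5's index and members
(`Node00.ResidB8.I8c`, `.lan`); the cut `λ.cutSubBP J lan c₁ ρ₀` pins Proposition 6's members to print's cubes over the law sub-index but leaves `J`, `lan` to the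
caller, and the slot reads `B8.Prop5Exists … lam.lan ∧ B8.Prop5Unique lam.lan` over the layer's OWN family.  In the ∃λ currency (dag-n05-w1's `…_rebind_…` entry point;
the four-pin engine's N05 row `∃ lam8, B8LeafOfRecordSubBP₂C θ₃ lam8`) a caller of `exists_residB8_b8LeafOfRecordSubBP₂C_of_lettersSrc_γ'` may therefore take
`J := PEmpty` — its `zdLan` hypotheses `hΩ0L hΩL htowerL SLetL SLetLU` are then vacuous and Proposition 5's conjuncts hold of the EMPTY family (junk inhabitation of a
typed conjunct, the FLAG №7 theme).  THE HONEST FAMILY is print's: Proposition 5 (p. 94) is stated for the sequence `{Ω_j}`, `𝔅_k` and a background `U₀ ∈ 𝔄_k({Ω_j}, α₀)`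
— i.e. for the Landau datum `zdLan θ.L B₁ ⟨i.η, i.k, i.Ω, i.Λs i.k, U₀⟩` of EVERY collar law member `i` (`Ω₀ = ℤᵈ`, `IdxB8LawsB`, `DomainSeq`) at EVERY unitary
background `U₀`.  On THAT family the `zdLan` letters are [4]'s letters at the law members THEMSELVES: `SLetL` is `SLet` (`B8SockLettersRD.SockLettersRD`, range form)
read at the top truncation `n := i.k`, `SLetUB`'s text IS `SLetLU`'s at the member, and the three laws `hΩ0L ∕ hΩL ∕ htowerL` are the member's `Ω₀ = ℤᵈ`,
`ZdIdx.hΩ`, `ZdIdx.htower`.  So the seven `zdLan` hypotheses DISAPPEAR, and the theorem CERTIFIES that the layer's Proposition-5 family contains the Landau datum of every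
collar law member at every unitary background.

WHAT IS PROVED (one theorem; `exists_residB8_layer` (the chosen constants, this seat) + ONE `exact` of p606531 at `J := {(i, U₀) ∕∕ laws}`; no estimate; no new definition):
* ★★★ **`exists_residB8_b8LeafOfRecordSubBP₂C_lawLan_of_lettersSrc_γ'`** — for `θ : Node00.Stage3Params` with `2 ≤ θ.D`, `5 ≤ θ.L`: [4]'s primitive constants
  with positivity guards and `2 ≤ 5dLB₀`; [4]'s letters `SLet ∕ SLetUB` and the b9 sockets `SB9P` (sourceless, Prop. 3's frame), `SH59src` (radius-uniform, Thm 4's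
  frame at (1.146)), `SB9srcHP` (sourced, Prop. 3's frame) at the COLLAR LAW MEMBERS — FIVE families, nothing else — ⊢ **`∃ lam : ResidB8 θ, B8LeafOfRecordSubBP₂C θ lam ∧
  ∀ i U₀, (law member, unitary) → ∃ a : lam.I8c, lam.lan a = zdLan θ.L lam.B₁ ⟨i.η, _, i.k, _, i.Ω, i.Λs i.k, U₀, _⟩`**.
HONEST FRAMING: bookkeeping (an index instantiation + `rfl` faces); 0 estimates; the five families are HYPOTHESES (N06 content; `m ≥ 1` OPEN; NOT claimed); Proposition 7
inside the slot in the repaired currency `c₇OfRecord` (WATCH-P7-CURRENCY-RECORD); whether the cut should PIN Proposition 5's index to this family (a `cutSubBP₅`-type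
successor of dag-n05-e's `Node00/CarriersB8SubBPCutP`) is the node00-def ∕ planners' word — declared here, not done here; count-neutral; **N05 NOT discharged**; Bałaban AS
PRINTED with locators; one finite 𝕋⁴ programme at fixed ε; nothing continuum ∕ ℝ⁴ ∕ OS ∕ mass-gap ∕ Clay.  No `sorry`, no new definition.  Unit `pub-ymgap-dag-n05-d` (g12).
[cite: Balaban1985RegularSpaces, Lemma 1 p.79, Thm 2 p.83, Prop. 3 p.87, Thm 4 p.88, Prop. 5 (1.106)–(1.110) p.94 («for U₀ ∈ 𝔄_k({Ω_j}, α₀)»), Prop. 6 p.99, Prop. 7 p.100, Thm 8 (1.146) p.101; Balaban1985BackgroundPropagators, Thm 3.1 p.397, Thm 3.3 p.398, (3.40) p.397]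
-/

noncomputable section

namespace Summit.QuantumFields.YangMills.BalabanUVNodes.N05SubBP2CSlotExistsLawLanGammaPrime

open Literature.MathematicalPhysics.QuantumFieldTheory.Balaban1983to89
open Literature.MathematicalPhysics.QuantumFieldTheory.Balaban1983to89.Node00
open Literature.MathematicalPhysics.QuantumFieldTheory.Balaban1983to89.B8IdxB8LawsB (IdxB8LawsB IdxB8SubB)
open Literature.MathematicalPhysics.QuantumFieldTheory.Balaban1983to89.B8LeafModelZd (ZdIdx)
open Literature.MathematicalPhysics.QuantumFieldTheory.Balaban1983to89.B8LeafModelZd3 (SockB9P3)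
open Literature.MathematicalPhysics.QuantumFieldTheory.Balaban1983to89.B9SupplySockB9P3ZdGammaUnivDelta2 (SockB9P3H2)
open Literature.MathematicalPhysics.QuantumFieldTheory.Balaban1983to89.B8LeafModelZd3P (zdGF3P zdGF3HP)
open Literature.MathematicalPhysics.QuantumFieldTheory.Balaban1983to89.B8LeafModelZd3P2 (zdGF3P₂ zdGF3HP₂)
open Literature.MathematicalPhysics.QuantumFieldTheory.Balaban1983to89.B8TowerBondsPrinted (towerBondsP)
open Literature.MathematicalPhysics.QuantumFieldTheory.Balaban1983to89.B8SockLettersRD (SockLettersRD)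
open Literature.MathematicalPhysics.QuantumFieldTheory.Balaban1983to89.B8Lemma1NonAbelian (mulCfg blockPairNA)
open Literature.MathematicalPhysics.QuantumFieldTheory.Balaban1983to89.B8LanF146 (LanF146)
open Literature.MathematicalPhysics.QuantumFieldTheory.Balaban1983to89.B8Eq138LandauZd (covLap QT InR138 IsLandau146W)
open Literature.MathematicalPhysics.QuantumFieldTheory.Balaban1983to89.B8Prop5LandauDataZd (ZdLanIdx zdLan)
open Summit.QuantumFields.YangMills.BalabanUVNodes.N05SubBP2CSlotGammaPrime (b8LeafOfRecordSubBP₂C_cutSubBP_zdLan_printCube_of_knit_lettersSrc_γ')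
open Summit.QuantumFields.YangMills.BalabanUVNodes.N05SubBP2CSlotExistsGammaPrime (exists_residB8_layer)
open MatrixLog B7Prop1Explicit B7Prop2Explicit B7Prop1Local B7Eq92Concrete
open B8Ineq130 (tlo thi)
open B8Ineq132 (InAk covDerivFwd)
open B7Eq78Linearization (zdBlocking QprimeIter)
open B8Eq119TwistedAxial (bgT Restr129 InAx)
open B8Eq140Level (SideTouches)
open B8Eq1117Concrete (XSpace)
open B8Prop5ContractionKLevel (Bd2)
open B8LambdaSpaceKLevel (wt)
open B8Eq184Proof (gaugeExp cfgExp)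
open B8Eq146AExpansion (iEta plaqCovDeriv)
open B8Eq143PlaqExpansion (pdiv)
open B7Prop4GeneralLevels (linCovIter)
open B8Eq155JBound (Jcur wsup)
open B8ScaledSupNorm (bondNorm msup Bdd)
open B9Eq340HolderZd (hquot AdmPair)

-- `Site` alone could resolve to the torus sites of `Setup.lean`; re-export the `ℤ^d` sites of `B7Prop1Explicit`.
export B7Prop1Explicit (Site)

section SlotExistsLawLan

/-- ★★★ **THE RE-PINNED SLOT INHABITED WITH THE HONEST PROPOSITION-5 FAMILY, FROM FIVE [4]-TYPE FAMILIES AT THE COLLAR LAW MEMBERS.**  For `θ` with `2 ≤ θ.D`,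
`5 ≤ θ.L`: [Balaban1985BackgroundPropagators]'s primitive constants (positivity guards, `2 ≤ 5dLB₀`), its letters `SLet ∕ SLetUB` and the b9 sockets `SB9P ∕ SH59src ∕
SB9srcHP` at the collar law members ⊢ a residual [B8] layer `lam` with `B8LeafOfRecordSubBP₂C θ lam` AND whose Proposition-5 family contains the Landau datum
`zdLan θ.L lam.B₁ ⟨i.η, _, i.k, _, i.Ω, i.Λs i.k, U₀, _⟩` of every collar law member `i` at every unitary background `U₀`.  Proof: `exists_residB8_layer`; Proposition 5's
index `J := {(i, U₀) ∕∕ Ω₀ = ℤᵈ ∧ IdxB8LawsB ∧ DomainSeq}`, members `ι (i, U₀) := ⟨i.η, i.hη, i.k, i.hk, i.Ω, i.Λs i.k, U₀, _⟩`; there the `zdLan` laws are `ZdIdx.hΩ ∕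
ZdIdx.htower`, `SLetL` is `SLet` at the top truncation, `SLetLU` is `SLetUB`; ONE `exact` of p606531; the certificate by `rfl`.  Sockets ∕ letters are HYPOTHESES (N06); N05
NOT discharged. [cite: Balaban1985RegularSpaces, Lemma 1 – Thm 8 pp.79–101, Prop. 5 (1.106)–(1.110) p.94, Thm 8 (1.146) p.101; Balaban1985BackgroundPropagators, Thm 3.1 p.397, Thm 3.3 p.398, (3.40) p.397] -/
theorem exists_residB8_b8LeafOfRecordSubBP₂C_lawLan_of_lettersSrc_γ' (θ : Stage3Params) (hD : 2 ≤ θ.D) (hL5 : 5 ≤ θ.L)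
    -- [Balaban1985BackgroundPropagators]'s PRIMITIVE constants read by the sockets: `B₀` (3.40), the Hölder pair `(β, B₀(β₀))` and length function, [4]'s letter bounds
    {B₀ B₀β β : ℝ} {len : Site θ.D → ℝ}
    {cB9 B₀'H B₂' BG BR cL : ℝ}
    (hcB9 : 0 < cB9) (hB₀'H : 0 < B₀'H) (hB₂' : 0 ≤ B₂') (hBG : 0 ≤ BG) (hBR : 0 ≤ BR) (hcL : 0 < cL)
    -- [4]'s letters AT THE `Ω₀ = ℤᵈ` LAW MEMBERS ONLY: existence side (laws on print's domains) and uniqueness side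
    (SLet : ∀ i : ZdIdx θ.D θ.L, i.Ω 0 = Set.univ → IdxB8LawsB θ.L i → B8ConstraintBonds.DomainSeq θ.L i.Ω → SockLettersRD (𝔸 := θ.𝔸) θ.L BG BR B₀'H B₂' cL i.η i.k i.Ω i.Λs)
    (SLetUB : ∀ i : ZdIdx θ.D θ.L, i.Ω 0 = Set.univ → IdxB8LawsB θ.L i → B8ConstraintBonds.DomainSeq θ.L i.Ω → ∀ α₀ : ℝ, 0 < α₀ → α₀ ≤ cL → ∀ U₀ : Site θ.D → Fin θ.D → θ.𝔸ˣ, (∀ x κ, U₀ x κ ∈ unitaryUnits θ.𝔸) →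
      InAk θ.L i.k i.η α₀ i.Ω U₀ →
      ∃ (g Δ : (Site θ.D → θ.𝔸) →ₗ[ℂ] (Site θ.D → θ.𝔸)) (q : (Site θ.D → θ.𝔸) →ₗ[ℂ] (ℕ → Site θ.D → θ.𝔸))
        (qs : (ℕ → Site θ.D → θ.𝔸) →ₗ[ℂ] (Site θ.D → θ.𝔸)) (Aw c : (ℕ → Site θ.D → θ.𝔸) →ₗ[ℂ] (ℕ → Site θ.D → θ.𝔸))
        (H' : XSpace θ.D i.k θ.𝔸 →ₗ[ℂ] (Site θ.D → θ.𝔸)),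
        (∀ x : Site θ.D → θ.𝔸, (∃ C : ℝ, ∀ y, ‖x y‖ ≤ C) → g (Δ x + qs (Aw (q x))) = x) ∧ (∀ φ, qs (c (q (g (g (qs φ))))) = qs φ) ∧
        (∀ (f : Site θ.D → θ.𝔸), ∀ x ∈ i.Ω 0, Δ f x = covLap i.η U₀ ((i.Ω 0).indicator f) x) ∧
        (∀ (μ : ℕ → Site θ.D → θ.𝔸), ∀ x ∈ i.Ω 0, qs μ x = QT θ.L i.k (i.Λs i.k) U₀ μ x) ∧
        (∀ (f : Site θ.D → θ.𝔸) (n : ℕ), n ≤ i.k → ∀ y ∈ i.Λs i.k n, q f n y = QprimeIter (zdBlocking θ.D θ.L) (bgT θ.L U₀) n f y) ∧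
        (∀ (f : Site θ.D → θ.𝔸) (n : ℕ) (y : Site θ.D), ¬ (n ≤ i.k ∧ y ∈ i.Λs i.k n) → q f n y = 0) ∧
        (∀ (X : XSpace θ.D i.k θ.𝔸) (x : Site θ.D), ‖H' X x‖ ≤ B₀'H * ‖X‖) ∧
        (∀ n, n ≤ i.k → ∀ (X : XSpace θ.D i.k θ.𝔸), ∀ p ∈ {b : Site θ.D × Fin θ.D | SideTouches (i.Ω n) b.1 b.2},
          wt θ.L i.η n * ‖covDerivFwd i.η U₀ p.2 (H' X) p.1‖ ≤ B₀'H * ‖X‖) ∧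
        (∀ X : XSpace θ.D i.k θ.𝔸, Bd2 θ.L i.η i.k i.Ω (covLap i.η U₀ (H' X)) (B₂' * ‖X‖)) ∧
        (∀ (Y : XSpace θ.D i.k θ.𝔸) (n : ℕ) (hn : n ≤ i.k) (y : Site θ.D), y ∈ i.Λs i.k n →
          QprimeIter (zdBlocking θ.D θ.L) (bgT θ.L U₀) n (H' Y) y = Y (⟨n, Nat.lt_succ_of_le hn⟩, y)) ∧
        (∀ (f : Site θ.D → θ.𝔸) (r : ℝ), 0 ≤ r → Bd2 θ.L i.η i.k i.Ω f r →
          (∀ x, ‖g f x‖ ≤ BG * r) ∧ ∀ n, n ≤ i.k → ∀ p ∈ {b : Site θ.D × Fin θ.D | SideTouches (i.Ω n) b.1 b.2},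
            wt θ.L i.η n * ‖covDerivFwd i.η U₀ p.2 (g f) p.1‖ ≤ BG * r) ∧
        (∀ (f : Site θ.D → θ.𝔸) (r : ℝ), 0 ≤ r → Bd2 θ.L i.η i.k i.Ω f r → Bd2 θ.L i.η i.k i.Ω (f - g (qs (c (q (g f))))) (BR * r)))
    -- the SOURCELESS b9 socket of Proposition 3's frame over PRINT's class, at the law members only ([4] Thm 3.3; threshold `cB9`) — for Prop. 3 AS PRINTED
    (SB9P : ∀ i : ZdIdx θ.D θ.L, i.Ω 0 = Set.univ → IdxB8LawsB θ.L i → B8ConstraintBonds.DomainSeq θ.L i.Ω →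
      SockB9P3H2 (𝔸 := θ.𝔸) θ.L B₀ B₀β cB9 β len i.η i.k i.Ω i.Λs (fun m j => towerBondsP θ.L i.Ω (i.Λs m) j))
    -- THEOREM 8's SOCKET-SIDE constants (source threshold `cP3`, source size factor `γ₈`, remainder slacks `γ′ γ″ γβ`) and the guard `2 ≤ 5dLB₀` on [4]'s `B₀` —
    -- NO layer equation, NO auxiliary `B₈ ∕ B₈β`, NO free-constant guard: those are CHOSEN ∕ DERIVED in the proof
    {cP3 γ₈ γ' γ'' γβ : ℝ} (hcP3 : 0 < cP3) (hγ₈ : 1 ≤ γ₈) (hγ' : 0 ≤ γ') (hγ'' : 0 ≤ γ'')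
    (hB : 2 ≤ 5 * (θ.D : ℝ) * θ.L * B₀) (hB₀β : 0 < B₀β)
    -- [Balaban1985BackgroundPropagators] Thm 3.3 WITH SOURCE in Theorem 4's frame at (1.146), γ′ letter, at the law members ONLY, asked RADIUS-UNIFORMLY: for every
    -- gauge-field radius scale `r ≥ 0` SOME threshold `c59 > 0` (print needs the one radius `r = O(B₁)`; [4] Thm 3.3 gives every `r` by shrinking its threshold) — HYPOTHESIS
    (SH59src : ∀ r : ℝ, 0 ≤ r → ∃ c59 : ℝ, 0 < c59 ∧ ∀ i : ZdIdx θ.D θ.L, i.Ω 0 = Set.univ → IdxB8LawsB θ.L i → B8ConstraintBonds.DomainSeq θ.L i.Ω → ∀ α₀ α₁ : ℝ, 0 < α₀ → 0 < α₁ → α₀ + α₁ ≤ c59 →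
      ∀ U₀ U' : Site θ.D → Fin θ.D → θ.𝔸ˣ, (∀ x κ, U₀ x κ ∈ unitaryUnits θ.𝔸) → (∀ x κ, U' x κ ∈ unitaryUnits θ.𝔸) →
      ∀ φ : Site θ.D → θ.𝔸, ((InR138 θ.L i.k i.η (i.Ω 0) (i.Λs i.k) U₀ φ ∧ (∀ x, IsSelfAdjoint (φ x)) ∧ (∀ x, x ∉ i.Ω 0 → φ x = 0) ∧
          Bdd θ.L i.k i.η (-(2 : ℝ)) (fun j (x : Site θ.D) => x ∈ i.Ω j) φ) ∧
        msup θ.L i.k i.η (-(2 : ℝ)) (fun j (x : Site θ.D) => x ∈ i.Ω j) φ < γ₈ * (α₀ + α₁)) →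
      InAk θ.L i.k i.η α₀ i.Ω U₀ → InAk θ.L i.k i.η α₀ i.Ω (mulCfg U' U₀) → (∀ m, m ≤ i.k → InAx θ.L m (i.Λs m) U₀ (mulCfg U' U₀)) →
      (∀ j, j ≤ i.k → ∀ (z : Site θ.D) (μ : Fin θ.D),
        ((∀ x, InBox (tlo θ.L z j) (thi θ.L z j) x → x ∈ i.Ω j) ∨ (∀ x, InBox (tlo θ.L (z + e μ) j) (thi θ.L (z + e μ) j) x → x ∈ i.Ω j)) →
        ‖(avgIter θ.L (mulCfg U' U₀) j z μ : θ.𝔸) - (avgIter θ.L U₀ j z μ : θ.𝔸)‖ ≤ α₁) →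
      (∀ b ∈ {b : Site θ.D × Fin θ.D | SideTouches (i.Ω 0) b.1 b.2}, ‖((U' b.1 b.2 : θ.𝔸ˣ) : θ.𝔸) - 1‖ ≤ α₁) →
      (∀ m, 1 ≤ m → m ≤ i.k → ∀ (u : Site θ.D → θ.𝔸ˣ) (W : Site θ.D → Fin θ.D → θ.𝔸ˣ) (A' : Site θ.D → Fin θ.D → θ.𝔸),
        (∀ x, u x ∈ unitaryUnits θ.𝔸) → mgauge U₀ u W = U' → Restr129 θ.L m (i.Λs m) U₀ u → LanF146 θ.L i.k i.η (i.Ω 0) i.Λs U₀ φ m W →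
        (∀ y τ, IsSelfAdjoint (A' y τ)) →
        (∀ j, j ≤ m → ∀ y τ, SideTouches (i.Ω j) y τ →
        W y τ = cfgExp i.η A' y τ ∧ ‖A' y τ‖ ≤ r * (α₀ + α₁) * ((θ.L : ℝ) ^ j * i.η)⁻¹) →
        (∀ y τ, (∀ j, j ≤ m → ¬ SideTouches (i.Ω j) y τ) → A' y τ = 0) →
        msup θ.L m i.η (-(1 : ℝ)) (fun j (b : Site θ.D × Fin θ.D) => SideTouches (i.Ω j) b.1 b.2) (fun b => A' b.1 b.2)
        ≤ B₀ * (bondNorm θ.L m i.η (-(3 : ℝ)) i.Ω (fun x μ => Jcur i.η U₀ A' μ x)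
        + wsup 1 (fun p : {p : ℕ × (Site θ.D × Fin θ.D) // p.1 ≤ m ∧ p.2 ∈ towerBondsP θ.L i.Ω (i.Λs m) p.1} =>
        linCovIter θ.L U₀ (iEta i.η A') p.1.1 p.1.2.1 p.1.2.2)) + γ' * B₀ * (α₀ + α₁) ∧
        msup θ.L m i.η (-(2 : ℝ)) (fun j (t : Fin θ.D × Fin θ.D × Site θ.D) => SideTouches (i.Ω j) t.2.2 t.2.1)
        (fun t => covDerivFwd i.η U₀ t.1 (fun z => A' z t.2.1) t.2.2)
        ≤ B₀ * (bondNorm θ.L m i.η (-(3 : ℝ)) i.Ω (fun x μ => Jcur i.η U₀ A' μ x)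
        + wsup 1 (fun p : {p : ℕ × (Site θ.D × Fin θ.D) // p.1 ≤ m ∧ p.2 ∈ towerBondsP θ.L i.Ω (i.Λs m) p.1} =>
        linCovIter θ.L U₀ (iEta i.η A') p.1.1 p.1.2.1 p.1.2.2)) + γ' * B₀ * (α₀ + α₁)))
    -- THE SOURCED b9 SOCKET OF PROPOSITION 3's FRAME at the `Ω₀ = ℤᵈ` law members, threshold `cP3`, `|B₁|` over print's class at the top truncation — HYPOTHESIS
    -- ([Balaban1985BackgroundPropagators] Thm 3.3 with source; = `B8Prop3SrcZd3HPGamma`'s input letter for letter)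
    (SB9srcHP : ∀ i : ZdIdx θ.D θ.L, i.Ω 0 = Set.univ → IdxB8LawsB θ.L i → B8ConstraintBonds.DomainSeq θ.L i.Ω → ∀ α₀ α₁ α₂ : ℝ, 0 < α₀ → α₀ ≤ cP3 → 0 < α₁ → 0 < α₂ → α₂ ≤ cP3 →
      ∀ (U₀ W : Site θ.D → Fin θ.D → θ.𝔸ˣ), (∀ x κ, U₀ x κ ∈ unitaryUnits θ.𝔸) → (∀ x κ, W x κ ∈ unitaryUnits θ.𝔸) →
      ∀ f : Site θ.D → θ.𝔸, InR138 θ.L i.k i.η (i.Ω 0) (i.Λs i.k) U₀ f →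
      (∀ x, IsSelfAdjoint (f x)) → (∀ x, x ∉ i.Ω 0 → f x = 0) →
      Bdd θ.L i.k i.η (-(2 : ℝ)) (fun j (x : Site θ.D) => x ∈ i.Ω j) f →
      msup θ.L i.k i.η (-(2 : ℝ)) (fun j (x : Site θ.D) => x ∈ i.Ω j) f < γ₈ * (α₀ + α₁) →
      msup θ.L i.k i.η (-(3 : ℝ)) (fun j (p : Fin θ.D × Site θ.D) => p.2 ∈ i.Ω j) (fun p => covDerivFwd i.η U₀ p.1 f p.2) < γ₈ * (α₀ + α₁) →
      InAk θ.L i.k i.η α₀ i.Ω U₀ → InAk θ.L i.k i.η α₀ i.Ω (mulCfg W U₀) → IsLandau146W θ.L i.k i.η (i.Ω 0) (i.Λs i.k) U₀ f W →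
      ∀ A' : Site θ.D → Fin θ.D → θ.𝔸, (∀ y τ, IsSelfAdjoint (A' y τ)) →
      (∀ j, j ≤ i.k → ∀ (y : Site θ.D) (τ : Fin θ.D), SideTouches (i.Ω j) y τ →
        W y τ = cfgExp i.η A' y τ ∧ ‖A' y τ‖ ≤ α₂ * ((θ.L : ℝ) ^ j * i.η)⁻¹) →
      (∀ (y : Site θ.D) (τ : Fin θ.D), (∀ j, j ≤ i.k → ¬ SideTouches (i.Ω j) y τ) → A' y τ = 0) →
      msup θ.L i.k i.η (-(1 : ℝ)) (fun j (b : Site θ.D × Fin θ.D) => SideTouches (i.Ω j) b.1 b.2) (fun b => A' b.1 b.2)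
          ≤ B₀ * (bondNorm θ.L i.k i.η (-(3 : ℝ)) i.Ω (fun x μ => Jcur i.η U₀ A' μ x)
            + wsup 1 (fun p : {p : ℕ × (Site θ.D × Fin θ.D) // p.1 ≤ i.k ∧ p.2 ∈ towerBondsP θ.L i.Ω (i.Λs i.k) p.1} =>
                linCovIter θ.L U₀ (iEta i.η A') p.1.1 p.1.2.1 p.1.2.2)) + γ'' * B₀ * (α₀ + α₁) ∧
        msup θ.L i.k i.η (-(2 : ℝ)) (fun j (t : Fin θ.D × Fin θ.D × Site θ.D) => SideTouches (i.Ω j) t.2.2 t.2.1)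
            (fun t => covDerivFwd i.η U₀ t.1 (fun z => A' z t.2.1) t.2.2)
          ≤ B₀ * (bondNorm θ.L i.k i.η (-(3 : ℝ)) i.Ω (fun x μ => Jcur i.η U₀ A' μ x)
            + wsup 1 (fun p : {p : ℕ × (Site θ.D × Fin θ.D) // p.1 ≤ i.k ∧ p.2 ∈ towerBondsP θ.L i.Ω (i.Λs i.k) p.1} =>
                linCovIter θ.L U₀ (iEta i.η A') p.1.1 p.1.2.1 p.1.2.2)) + γ'' * B₀ * (α₀ + α₁) ∧
        bondNorm θ.L i.k i.η (-(3 : ℝ)) i.Ω (fun x μ => pdiv i.η U₀ (plaqCovDeriv i.η U₀ A') μ x)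
          ≤ B₀ * (bondNorm θ.L i.k i.η (-(3 : ℝ)) i.Ω (fun x μ => Jcur i.η U₀ A' μ x)
            + wsup 1 (fun p : {p : ℕ × (Site θ.D × Fin θ.D) // p.1 ≤ i.k ∧ p.2 ∈ towerBondsP θ.L i.Ω (i.Λs i.k) p.1} =>
                linCovIter θ.L U₀ (iEta i.η A') p.1.1 p.1.2.1 p.1.2.2)) + γ'' * B₀ * (α₀ + α₁) ∧
        bondNorm θ.L i.k i.η (-(3 : ℝ)) i.Ω (fun x μ => covLap i.η U₀ (fun z => A' z μ) x)
          ≤ B₀ * (bondNorm θ.L i.k i.η (-(3 : ℝ)) i.Ω (fun x μ => Jcur i.η U₀ A' μ x)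
            + wsup 1 (fun p : {p : ℕ × (Site θ.D × Fin θ.D) // p.1 ≤ i.k ∧ p.2 ∈ towerBondsP θ.L i.Ω (i.Λs i.k) p.1} =>
                linCovIter θ.L U₀ (iEta i.η A') p.1.1 p.1.2.1 p.1.2.2)) + γ'' * B₀ * (α₀ + α₁) ∧
        msup θ.L i.k i.η (-(2 + β)) (fun j (q : Fin θ.D × Fin θ.D × (Site θ.D × Site θ.D)) => q.2.2 ∈ AdmPair i.η len ∧ q.2.2.1 ∈ i.Ω j ∧ q.2.2.2 ∈ i.Ω j)
            (fun q => hquot i.η β len U₀ (covDerivFwd i.η U₀ q.1 (fun z => A' z q.2.1)) q.2.2)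
          ≤ B₀β * (bondNorm θ.L i.k i.η (-(3 : ℝ)) i.Ω (fun x μ => Jcur i.η U₀ A' μ x)
            + wsup 1 (fun p : {p : ℕ × (Site θ.D × Fin θ.D) // p.1 ≤ i.k ∧ p.2 ∈ towerBondsP θ.L i.Ω (i.Λs i.k) p.1} =>
                linCovIter θ.L U₀ (iEta i.η A') p.1.1 p.1.2.1 p.1.2.2)) + γβ * (α₀ + α₁)) :
    ∃ lam : ResidB8 θ, B8LeafOfRecordSubBP₂C θ lam ∧
      ∀ (i : ZdIdx θ.D θ.L) (U₀ : Site θ.D → Fin θ.D → θ.𝔸ˣ) (hU₀ : ∀ x κ, U₀ x κ ∈ unitaryUnits θ.𝔸),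
        i.Ω 0 = Set.univ → IdxB8LawsB θ.L i → B8ConstraintBonds.DomainSeq θ.L i.Ω →
        ∃ a : lam.I8c, lam.lan a = zdLan θ.L lam.B₁ ⟨i.η, i.hη, i.k, i.hk, i.Ω, i.Λs i.k, U₀, hU₀⟩ := by
  -- the chosen constants and layer (this seat's `exists_residB8_layer`): Theorem 8's bookkeeping, Prop-6 witness clause, free-constant guards, radius ≥ 0
  obtain ⟨ρ₀, B₁s, c₁s, B₈, B₈β, lam, hP6, rfl, rfl, rfl, rfl, hC₂eq, hB₁', hB₁eq, hB₂eq, hB₁big, -, hB₀8, hγB, hγB'', hB8β, hfree2, hfreeS, hr0⟩ :=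
    exists_residB8_layer θ hD hL5 (β := β) (len := len) (B₀β := B₀β) hBG hBR γβ hγ₈ hγ' hγ'' hB
  -- [4] Thm 3.3 with source at Theorem 8's gauge-field radius
  obtain ⟨c59, hc59, SH⟩ := SH59src _ hr0
  -- PROPOSITION 5's HONEST INDEX: (collar law member, unitary background); members = the member's own Landau datum at the top truncation
  let J : Type := {p : ZdIdx θ.D θ.L × {U : Site θ.D → Fin θ.D → θ.𝔸ˣ // ∀ x κ, U x κ ∈ unitaryUnits θ.𝔸} //
    p.1.Ω 0 = Set.univ ∧ IdxB8LawsB θ.L p.1 ∧ B8ConstraintBonds.DomainSeq θ.L p.1.Ω}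
  let ι : J → ZdLanIdx θ.D θ.𝔸 := fun a => ⟨a.1.1.η, a.1.1.hη, a.1.1.k, a.1.1.hk, a.1.1.Ω, a.1.1.Λs a.1.1.k, a.1.2.1, a.1.2.2⟩
  refine ⟨lam.cutSubBP J (fun a : J => zdLan θ.L lam.B₁ (ι a)) c₁s ρ₀,
    b8LeafOfRecordSubBP₂C_cutSubBP_zdLan_printCube_of_knit_lettersSrc_γ' lam hD hC₂eq hcB9 hB₀'H hB₂' hBG hBR hcL SLet SLetUB SB9P hfree2 ι
      (fun a => a.2.1) (fun a j => a.1.1.hΩ j) (fun a j hj y hy x hx => a.1.1.htower j hj y hy x hx) ?_ ?_ hP6 hB₁big hc59 hcP3 hγ₈ hγ' hγ'' hB hB₀β hB₀8 hγB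
      hγB'' hB8β hB₁' hB₁eq hB₂eq hfreeS
      (fun i hΩ hl hd α₀ α₁ hα₀ hα₁ hαc U₀ U' hU₀ hU' φ hφ hIn hIn' hAx h135 hbd m hm1 hmk u W A' hu hg hR hLan hsa hW hA0 =>
        SH i hΩ hl hd α₀ α₁ hα₀ hα₁ hαc U₀ U' hU₀ hU' φ hφ hIn hIn' hAx h135 hbd m hm1 hmk u W A' hu hg hR hLan hsa
          (fun j hj y τ hst => ⟨(hW j hj y τ hst).1, (hW j hj y τ hst).2.trans_eq (by ring)⟩) hA0)
      SB9srcHP,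
    fun i U₀ hU₀ hΩ hl hd => ⟨(⟨(i, ⟨U₀, hU₀⟩), hΩ, hl, hd⟩ : J), rfl⟩⟩
  · -- `SLetL` IS [4]'s range-form letter package `SLet` at the member, read at the top truncation `n := i.k`
    intro a α₀ hα₀ hαL hIn
    exact SLet a.1.1 a.2.1 a.2.2.1 a.2.2.2 α₀ hα₀ hαL a.1.2.1 a.1.2.2 hIn a.1.1.k a.1.1.hk le_rfl
  · -- `SLetLU` IS [4]'s uniqueness-side letter package `SLetUB` at the member
    intro a α₀ hα₀ hαL hIn
    exact SLetUB a.1.1 a.2.1 a.2.2.1 a.2.2.2 α₀ hα₀ hαL a.1.2.1 a.1.2.2 hIn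

end SlotExistsLawLan

/-! ## SUPERSEDED — EX FALSO AS TYPED (v1.1 DOC-ONLY note, dag-n05-d g12, 2026-08-28; all declarations byte-identical)

dag-n05-w1's certificate `B8SockLettersRDIdxB8LawsBVacuity.sLet_idxB8LawsB_unsatisfiable_stage3 θ hcL SLet : False` (p613168) shows that the binder `SLet` (and `SLetUB`)
displayed by `exists_residB8_b8LeafOfRecordSubBP₂C_lawLan_of_lettersSrc_γ'` (the ★★★ above) — [Balaban1985BackgroundPropagators]'s letters demanded at EVERY member of the class `Ω₀ = ℤᵈ ∧ IdxB8LawsB ∧ DomainSeq` — is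
UNSATISFIABLE: the class admits the all-`univ` datum `i⋆` (`Λs ≡ ⊤`, `k = 1`), at which `SockLettersRD`'s interpolation clause `Q′ⱼ(H′Y)(y) = Y(j,y)` over
`Λ₀ = Λ₁ = ℤᵈ` is contradictory.  Hence that theorem holds EX FALSO AS TYPED and certifies nothing; it is kept for the record and SUPERSEDED by its «P₂D» twin
`BalabanUVNodesN05SubBP2DSlotExistsLawLanGammaPrime.exists_residB8_b8LeafOfRecordSubBP₂D_cutSubBP₅_of_lettersSrc_γ'` (p619291; Proposition 5's family pinned by name at dag-n05-w1's P₅-pin, so the certificate conjunct is structural there), whose binders demand the letters only at the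
(1.3)–(1.5)-ADMISSIBLE members (print's (1.5) `Λ_j = Ω_j^{(j)} ∖ Ω_{j+1}^{(j)}` conjoined as «`∀ l, l < i.k → ∀ z ∈ i.Λs i.k l, ((θ.L : ℤ) ^ l) • z ∈ B8ConstraintBonds.Lam θ.L i.Ω l`»,
dag-n05-c's repair letter; the class then excludes `i⋆`, dag-n05-c `B8IdxB8LamTopTowerDisjoint.not_lamTop_allUniv`).  Nothing else in this file.
[cite: Balaban1985RegularSpaces, (1.5) p.77; Balaban1985BackgroundPropagators, Thm 3.1 p.397 (the letters' member class)] -/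

end Summit.QuantumFields.YangMills.BalabanUVNodes.N05SubBP2CSlotExistsLawLanGammaPrime

end
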